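import Summits.QuantumFields.YangMills.Theorems.SwapVirialDeficitSectorStiffnessCore
import Summits.QuantumFields.YangMills.Theorems.SwapVirialDeficitSectorLaplaceMbDensityBulkIntegrable
import Summits.QuantumFields.YangMills.Theorems.SwapVirialDeficitSectorLaplaceMbConstFloor
import HarnessLib

/-!
# (S)-road ➎, stub (S-bulk) part 1: THE BULK REGION'S MORSE–BOTT MASS HAS A POLYNOMIAL-EXPONENTIAL FLOOR
# (free-hands support of ⟨stmt-QuantumFields-24197⟩ `SwapVirialDeficit.SwapGluedStiffness`; cell ym-idea-1, LEAD g98 memo6, assembler fcl-p3 g47)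

The bulk stub of skeleton ➎ (`stub_bulk_stiff_sur`, surplus `1∕16`) is a two-sided log-Laplace law for `Z_ε(b) = ∫_{HubBulk τ} I(a,ε;b) da` per good sign pattern, whose
main constant is the bulk Morse–Bott mass `M_ε(τ) = ∫_{HubBulk τ}∫_{ℝ²} 𝔪(a,ε,p) dp da`.  To eat the ABSOLUTE off-tube term `(∫ρ)·e^{−b(τ∕KL^k)^k}` of w2 g59's
✓`bulk_fibred_plane` one needs `M_ε(τ) ≥ e^{−poly(L)}` and `∫ρ ≤ e^{poly(L)}`.  This file:

* §1 `coneMeasure_real_pos_of_ball` (cone measure of an open set meeting the unit ball is positive), ★ `coneMeasure_hubBulk_half_pos` (`0 < cone(HubBulk ½)`: the open cone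
  `{hubS1 > ½, hubS2 > ½}` contains `(¼, ½, 0, 0)`);
* §2 ★ `planeMass_ge` — at a hub with `re a ≠ 0`, `im a ≠ 0`, good `ε`, `p ↦ 𝔪` integrable: `¼·(20400L⁴)^{−α} ≤ ∫_{ℝ²}𝔪(a,ε,·)` (w2 ✓`mbDensity_ge`, LEAD ✓`gnoDensity_gnoBase_ge`
  on the unit box of area `4`); `integrable_planeMass_of_hubBulk` (w2 ✓`exists_mbDensity_le_weight_of_hubBulk`);
* §3 ★★ `bulkMass_floor` — `cone(HubBulk ½)·¼·(20400L⁴)^{−α} ≤ M_ε(τ)` for `0 < τ ≤ ½`; ★ `bulkMass_exp_floor` — `cone(HubBulk ½)·e^{−183602L⁸} ≤ M_ε(τ)`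
  (✓`fibre_prefactor_floor`); `bulkMass_pos`;
* §4 ★ `totalMass_le_exp` — `∫ρ ≤ e^{|log(coneConst³∕64)| + 18L⁴}` (✓`gnomonic_total_mass_real`, ✓`KL_floor`).

HONEST LABEL: measure-theoretic bricks for (S-bulk); the stub itself is part 3; ⟨24197⟩ ∕ ⟨24194⟩ OPEN; ⟨24196⟩ proved elsewhere; item of record ⟨24085⟩ SubOctaveBounded aside ∕
untouched; the Yang–Mills mass gap is NOT proved; no summit is proved by a line.  THEOREMS ONLY (0 `def`, 0 `sorry`), standard axioms; the `attribute [local instance]`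
block is the chart's measurable structure on `ℍ` (as in ✓`SectorLaplaceDefs`; nothing overridden).  Seat ym-line-fcl-p3 g47 (cell ym-idea-1, free hands),
`--supports stmt-QuantumFields-24197`.  References: [cite: Luscher1983, §2]; [folklore].
-/

set_option autoImplicit false
set_option synthInstance.maxSize 1024

noncomputable section

open MeasureTheory Quaternion Set
open scoped Quaternion BigOperators ENNReal
open Literature.MathematicalPhysics.QuantumLattice
open Literature.MathematicalPhysics.QuantumFieldTheory hiding SU2
open Summit.QuantumFields.YangMills.Theorems.SwapTwistDeficit.ToronLog

attribute [local instance] Literature.Analysis.FluidPDE.Tao2016.quatMeasurableSpace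
  Literature.Analysis.FluidPDE.Tao2016.quatBorelSpace
  Literature.MathematicalPhysics.QuantumLattice.secondCountableTopology_su2

namespace Summit.QuantumFields.YangMills.Theorems.SwapVirialDeficit.SectorLaplace

open Summit.QuantumFields.YangMills.Theorems.FemtoTransferGap
open Summit.QuantumFields.YangMills.Theorems.FemtoTransferGap.TT
open Summit.QuantumFields.YangMills.Theorems.VirialFluxGap.RingDeficit
open Summit.QuantumFields.YangMills.Theorems.SwapVirialDeficit.SwapRing
open Summit.QuantumFields.YangMills.Theorems.SwapVirialDeficit.BlowUpRing

/-! ## §1 The cone measure of the bulk hubs is positive -/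

/-- The cone measure of an open set meeting the open unit ball is positive. [folklore] -/
theorem coneMeasure_real_pos_of_ball {U : Set ℍ} (hU : IsOpen U) (hne : (U ∩ Metric.ball (0 : ℍ) 1).Nonempty) : 0 < coneMeasure.real U := by
  have hvolU : 0 < (volume : Measure ℍ) (U ∩ Metric.ball 0 1) := (hU.inter Metric.isOpen_ball).measure_pos volume hne
  have hball : (volume : Measure ℍ) (Metric.ball (0 : ℍ) 1) ≠ 0 := (Metric.isOpen_ball.measure_pos volume ⟨0, Metric.mem_ball_self one_pos⟩).ne'
  have hballT : (volume : Measure ℍ) (Metric.ball (0 : ℍ) 1) ≠ ⊤ := measure_ball_lt_top.ne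
  have hcone : coneMeasure U = ((volume : Measure ℍ) (Metric.ball 0 1))⁻¹ * (volume : Measure ℍ) (U ∩ Metric.ball 0 1) := by
    unfold coneMeasure
    rw [Measure.smul_apply, Measure.restrict_apply' Metric.isOpen_ball.measurableSet, smul_eq_mul]
  rw [measureReal_def, hcone, ENNReal.toReal_mul]
  refine mul_pos ?_ (ENNReal.toReal_pos hvolU.ne' (measure_ne_top_of_subset Set.inter_subset_right hballT))
  exact ENNReal.toReal_pos (ENNReal.inv_ne_zero.2 hballT) (ENNReal.inv_ne_top.2 hball)

/-- The hub stiffnesses are continuous away from the origin. [folklore] -/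
theorem continuousAt_hubS {a : ℍ} (ha : a ≠ 0) : ContinuousAt hubS1 a ∧ ContinuousAt hubS2 a := by
  have hn : ContinuousAt (fun b : ℍ => ‖b‖⁻¹) a := (continuous_norm.continuousAt).inv₀ (norm_ne_zero_iff.2 ha)
  have hre : ContinuousAt (fun b : ℍ => b.re) a := Quaternion.continuous_re.continuousAt
  have him : ContinuousAt (fun b : ℍ => ‖b.im‖) a := (Quaternion.continuous_im.norm).continuousAt
  refine ⟨?_, ?_⟩
  · have h : ContinuousAt (fun b : ℍ => (2 * (‖b‖⁻¹ * b.re) * (‖b‖⁻¹ * ‖b.im‖)) ^ 2) a :=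
      ((continuousAt_const.mul (hn.mul hre)).mul (hn.mul him)).pow 2
    exact h
  · have h : ContinuousAt (fun b : ℍ => (‖b‖⁻¹ * ‖b.im‖) ^ 2) a := (hn.mul him).pow 2
    exact h

/-- The open cone `{hubS1 > ½, hubS2 > ½}` is open (it avoids the origin, where `hubS2 = 0`). [folklore] -/
theorem isOpen_hubBulkCone : IsOpen {a : ℍ | 1 / 2 < hubS1 a ∧ 1 / 2 < hubS2 a} := by
  rw [isOpen_iff_mem_nhds]
  intro a ha
  have ha0 : a ≠ 0 := by
    rintro rfl
    have h := ha.2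
    rw [hubS2_zero] at h
    norm_num at h
  obtain ⟨h1, h2⟩ := continuousAt_hubS ha0
  exact Filter.inter_mem (h1.preimage_mem_nhds (Ioi_mem_nhds ha.1)) (h2.preimage_mem_nhds (Ioi_mem_nhds ha.2))

/-- The open cone lies in `HubBulk ½`. [folklore] -/
theorem hubBulkCone_subset : {a : ℍ | 1 / 2 < hubS1 a ∧ 1 / 2 < hubS2 a} ⊆ HubBulk (1 / 2) := by
  intro a ha
  have ha0 : a ≠ 0 := by
    rintro rfl
    have h := ha.2
    rw [hubS2_zero] at h
    norm_num at h
  exact ⟨ha0, ha.1.le, ha.2.le⟩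

/-- The hub `(¼, ½, 0, 0)` lies in the open cone and in the unit ball (`hubS1 = 16∕25`, `hubS2 = 4∕5`, `‖·‖² = 5∕16`). [folklore] -/
theorem hubBulkCone_witness :
    (⟨1 / 4, 1 / 2, 0, 0⟩ : ℍ) ∈ {a : ℍ | 1 / 2 < hubS1 a ∧ 1 / 2 < hubS2 a} ∩ Metric.ball (0 : ℍ) 1 := by
  set a : ℍ := ⟨1 / 4, 1 / 2, 0, 0⟩ with ha
  have hna : ‖a‖ * ‖a‖ = 5 / 16 := by
    rw [← Quaternion.normSq_eq_norm_mul_self, Quaternion.normSq_def']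
    simp [ha]; norm_num
  have hni : ‖a.im‖ * ‖a.im‖ = 1 / 4 := by
    rw [← Quaternion.normSq_eq_norm_mul_self, Quaternion.normSq_def']
    simp [ha]; norm_num
  have hre : a.re = 1 / 4 := rfl
  have hn0 : 0 < ‖a‖ := by nlinarith [norm_nonneg a]
  have hS2 : hubS2 a = 4 / 5 := by
    unfold hubS2
    rw [mul_pow, inv_pow, sq, sq, hna, hni]; norm_num
  have hS1 : hubS1 a = 16 / 25 := by
    unfold hubS1
    have e : (2 * (‖a‖⁻¹ * a.re) * (‖a‖⁻¹ * ‖a.im‖)) ^ 2 = 4 * a.re ^ 2 * (‖a.im‖ * ‖a.im‖) * ((‖a‖ * ‖a‖) * (‖a‖ * ‖a‖))⁻¹ := by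
      field_simp
      ring
    rw [e, hni, hna, hre]; norm_num
  refine ⟨⟨by rw [hS1]; norm_num, by rw [hS2]; norm_num⟩, ?_⟩
  rw [Metric.mem_ball, dist_zero_right]
  nlinarith [norm_nonneg a]

/-- ★ **THE CONE MEASURE OF THE BULK HUBS AT CUT `½` IS POSITIVE.** [folklore] -/
theorem coneMeasure_hubBulk_half_pos : 0 < coneMeasure.real (HubBulk (1 / 2)) := by
  haveI := isProbabilityMeasure_coneMeasure
  have h := coneMeasure_real_pos_of_ball isOpen_hubBulkCone ⟨_, hubBulkCone_witness⟩
  exact lt_of_lt_of_le h (measureReal_mono hubBulkCone_subset)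

/-- `HubBulk` is antitone in the cut. [folklore] -/
theorem hubBulk_mono {τ τ' : ℝ} (h : τ ≤ τ') : HubBulk τ' ⊆ HubBulk τ :=
  fun _ ha => ⟨ha.1, h.trans ha.2.1, h.trans ha.2.2⟩

/-! ## §2 The whole-plane Morse–Bott mass at a bulk hub -/

variable {L : ℕ} [NeZero L]

/-- The unit base box has area `4`. [folklore] -/
theorem volume_baseBox_one : (volume : Measure (ℝ × ℝ)) (BaseBox 1) = ENNReal.ofReal 4 := by
  have e : BaseBox (1 : ℝ) = Set.Icc (-1 : ℝ) 1 ×ˢ Set.Icc (-1 : ℝ) 1 := by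
    ext p; simp only [BaseBox, Set.mem_setOf_eq, Set.mem_prod, Set.mem_Icc, abs_le]
  rw [e, Measure.volume_eq_prod, Measure.prod_prod, Real.volume_Icc, ← ENNReal.ofReal_mul (by norm_num)]
  norm_num

/-- The unit base box has area `4` (real form). [folklore] -/
theorem volume_real_baseBox_one : (volume : Measure (ℝ × ℝ)).real (BaseBox 1) = 4 := by
  rw [measureReal_def, volume_baseBox_one, ENNReal.toReal_ofReal (by norm_num)]

/-- At a bulk hub the whole-plane density is integrable (w2 g59 ✓`exists_mbDensity_le_weight_of_hubBulk`, ✓`measurable_mbDensity_base`). [folklore] -/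
theorem integrable_planeMass_of_hubBulk {ε : GnoSign L} (hε : GoodSign ε) {τ : ℝ} (hτ : 0 < τ) (hτ1 : τ ≤ 1) {a : ℍ} (ha : a ∈ HubBulk τ) :
    Integrable (fun p : ℝ × ℝ => mbDensity (L := L) a ε p) := by
  obtain ⟨C, hC0, hC⟩ := exists_mbDensity_le_weight_of_hubBulk (L := L) hε hτ hτ1
  have hw : Integrable (fun p : ℝ × ℝ => C * ((1 + p.1 ^ 2)⁻¹ * (1 + p.2 ^ 2)⁻¹)) := by
    have h1 : Integrable (fun p : ℝ × ℝ => (1 + p.1 ^ 2)⁻¹ * (1 + p.2 ^ 2)⁻¹) ((volume : Measure ℝ).prod volume) :=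
      integrable_inv_one_add_sq.mul_prod integrable_inv_one_add_sq
    rw [← Measure.volume_eq_prod] at h1
    exact h1.const_mul C
  refine hw.mono' (measurable_mbDensity_base ha.1 ε).aestronglyMeasurable (Filter.Eventually.of_forall fun p => ?_)
  rw [Real.norm_eq_abs, abs_of_nonneg (mbDensity_nonneg a ε p)]
  exact hC a ha p

/-- ★ **THE PLANE MASS FLOOR**: at a hub with `re a ≠ 0`, `im a ≠ 0`, good signs and integrable `p ↦ 𝔪`, `¼·(20400L⁴)^{−α} ≤ ∫_{ℝ²} 𝔪(a,ε,·)`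
(the unit box of area `4`, `ρ(gnoBase p) ≥ 1∕16` there, ✓`mbDensity_ge`). [cite: Luscher1983, §2] -/
theorem planeMass_ge {a : ℍ} (hre : a.re ≠ 0) (him : a.im ≠ 0) {ε : GnoSign L} (hε : GoodSign ε)
    (hint : Integrable (fun p : ℝ × ℝ => mbDensity (L := L) a ε p)) :
    (1 / 4 : ℝ) * (20400 * (L : ℝ) ^ 4) ^ (-alpha L) ≤ ∫ p : ℝ × ℝ, mbDensity (L := L) a ε p := by
  have hL0 : (0 : ℝ) < L := by exact_mod_cast NeZero.pos L
  have hΛ : 0 < (20400 * (L : ℝ) ^ 4) ^ (-alpha L) := Real.rpow_pos_of_pos (by positivity) _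
  have hbox : ∀ p ∈ BaseBox (1 : ℝ), (1 / 16 : ℝ) * (20400 * (L : ℝ) ^ 4) ^ (-alpha L) ≤ mbDensity (L := L) a ε p := by
    intro p hp
    have h1 := gnoDensity_gnoBase_ge (L := L) hp.1 hp.2
    have h2 := mbDensity_ge (L := L) hre him hε p
    exact le_trans (mul_le_mul_of_nonneg_right h1 hΛ.le) h2
  calc (1 / 4 : ℝ) * (20400 * (L : ℝ) ^ 4) ^ (-alpha L)
      = (volume : Measure (ℝ × ℝ)).real (BaseBox 1) * ((1 / 16 : ℝ) * (20400 * (L : ℝ) ^ 4) ^ (-alpha L)) := by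
        rw [volume_real_baseBox_one]; ring
    _ = ∫ _p in BaseBox (1 : ℝ), (1 / 16 : ℝ) * (20400 * (L : ℝ) ^ 4) ^ (-alpha L) := by rw [setIntegral_const, smul_eq_mul]
    _ ≤ ∫ p in BaseBox (1 : ℝ), mbDensity (L := L) a ε p := by
        have hc : IntegrableOn (fun _ : ℝ × ℝ => (1 / 16 : ℝ) * (20400 * (L : ℝ) ^ 4) ^ (-alpha L)) (BaseBox 1) volume := by
          rw [integrableOn_const_iff]
          exact Or.inr (by rw [volume_baseBox_one]; exact ENNReal.ofReal_lt_top)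
        exact setIntegral_mono_on hc hint.integrableOn (measurableSet_baseBox 1) hbox
    _ ≤ ∫ p : ℝ × ℝ, mbDensity (L := L) a ε p := setIntegral_le_integral hint (Filter.Eventually.of_forall fun p => mbDensity_nonneg a ε p)

/-! ## §3 The bulk Morse–Bott mass floor -/

/-- ★★ **THE BULK MASS FLOOR**: for good `ε` and `0 < τ ≤ ½`, `cone(HubBulk ½)·¼·(20400L⁴)^{−α} ≤ ∫_{HubBulk τ}∫_{ℝ²}𝔪(a,ε,·) da`. [cite: Luscher1983, §2] -/
theorem bulkMass_floor {ε : GnoSign L} (hε : GoodSign ε) {τ : ℝ} (hτ : 0 < τ) (hτ1 : τ ≤ 1 / 2) :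
    coneMeasure.real (HubBulk (1 / 2)) * ((1 / 4 : ℝ) * (20400 * (L : ℝ) ^ 4) ^ (-alpha L)) ≤
      ∫ a in HubBulk τ, (∫ p : ℝ × ℝ, mbDensity (L := L) a ε p) ∂coneMeasure := by
  haveI := isProbabilityMeasure_coneMeasure
  have hint : IntegrableOn (fun a : ℍ => ∫ p : ℝ × ℝ, mbDensity (L := L) a ε p) (HubBulk τ) coneMeasure :=
    integrableOn_integral_mbDensity_hubBulk (L := L) hε hτ (by linarith)
  have hsub : HubBulk (1 / 2 : ℝ) ⊆ HubBulk τ := hubBulk_mono hτ1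
  have hhalf : IntegrableOn (fun a : ℍ => ∫ p : ℝ × ℝ, mbDensity (L := L) a ε p) (HubBulk (1 / 2)) coneMeasure := hint.mono_set hsub
  calc coneMeasure.real (HubBulk (1 / 2)) * ((1 / 4 : ℝ) * (20400 * (L : ℝ) ^ 4) ^ (-alpha L))
      = ∫ _a in HubBulk (1 / 2 : ℝ), (1 / 4 : ℝ) * (20400 * (L : ℝ) ^ 4) ^ (-alpha L) ∂coneMeasure := by rw [setIntegral_const, smul_eq_mul]
    _ ≤ ∫ a in HubBulk (1 / 2 : ℝ), (∫ p : ℝ × ℝ, mbDensity (L := L) a ε p) ∂coneMeasure := by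
        have hc : IntegrableOn (fun _ : ℍ => (1 / 4 : ℝ) * (20400 * (L : ℝ) ^ 4) ^ (-alpha L)) (HubBulk (1 / 2)) coneMeasure := by
          rw [integrableOn_const_iff]
          exact Or.inr (measure_lt_top _ _)
        refine setIntegral_mono_on_ae hc hhalf (measurableSet_hubBulk _) ?_
        refine (ae_re_ne_zero_im_ne_zero_coneMeasure).mono fun a ha hmem => ?_
        exact planeMass_ge ha.1 ha.2 hε (integrable_planeMass_of_hubBulk hε (by norm_num) (by norm_num) hmem)
    _ ≤ ∫ a in HubBulk τ, (∫ p : ℝ × ℝ, mbDensity (L := L) a ε p) ∂coneMeasure :=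
        setIntegral_mono_set hint (Filter.Eventually.of_forall fun a => integral_nonneg fun p => mbDensity_nonneg a ε p)
          (Filter.Eventually.of_forall hsub)

/-- ★ **THE BULK MASS FLOOR, EXPONENTIAL FORM**: `cone(HubBulk ½)·e^{−183602·L⁸} ≤ ∫_{HubBulk τ}∫𝔪_ε` (✓`fibre_prefactor_floor`). [folklore] -/
theorem bulkMass_exp_floor {ε : GnoSign L} (hε : GoodSign ε) {τ : ℝ} (hτ : 0 < τ) (hτ1 : τ ≤ 1 / 2) :
    coneMeasure.real (HubBulk (1 / 2)) * Real.exp (-(183602 * (L : ℝ) ^ 8)) ≤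
      ∫ a in HubBulk τ, (∫ p : ℝ × ℝ, mbDensity (L := L) a ε p) ∂coneMeasure :=
  le_trans (mul_le_mul_of_nonneg_left fibre_prefactor_floor measureReal_nonneg) (bulkMass_floor hε hτ hτ1)

/-- The bulk mass is positive. [folklore] -/
theorem bulkMass_pos {ε : GnoSign L} (hε : GoodSign ε) {τ : ℝ} (hτ : 0 < τ) (hτ1 : τ ≤ 1 / 2) :
    0 < ∫ a in HubBulk τ, (∫ p : ℝ × ℝ, mbDensity (L := L) a ε p) ∂coneMeasure :=
  lt_of_lt_of_le (mul_pos coneMeasure_hubBulk_half_pos (Real.exp_pos _)) (bulkMass_exp_floor hε hτ hτ1)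

/-! ## §4 The total gnomonic mass is at most exponentially large -/

/-- ★ **THE TOTAL MASS CEILING**: `∫ρ ≤ e^{|log(coneConst³∕64)| + 18L⁴}` (`K_L·Σ_ε∫ρ = 1`, ✓`gnomonic_total_mass_real`; `K_L ≥ e^{−(|log c₀| + 18L⁴)}`, ✓`KL_floor`). [folklore] -/
theorem totalMass_le_exp : ∫ η : GnoCoord L, gnoDensity η ≤ Real.exp (|Real.log (coneConst ^ 3 / 64)| + 18 * (L : ℝ) ^ 4) := by
  have htot := gnomonic_total_mass_real (L := L) (χ := fun _ => (1 : SU2)) one_central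
  have hKL := KL_floor (L := L)
  have hρ0 : 0 ≤ ∫ η : GnoCoord L, gnoDensity η := integral_nonneg fun η => (gnoDensity_pos η).le
  have hKL0 : 0 < KL L := lt_of_lt_of_le (Real.exp_pos _) hKL
  -- `K_L · ∫ρ ≤ K_L · Σ_ε ∫ρ = 1`
  have hcard : (1 : ℝ) ≤ (Fintype.card (GnoSign L) : ℝ) := by
    have : 0 < Fintype.card (GnoSign L) := Fintype.card_pos
    exact_mod_cast this
  have hsum : ∑ _ε : GnoSign L, ∫ η : GnoCoord L, gnoDensity η = (Fintype.card (GnoSign L) : ℝ) * ∫ η : GnoCoord L, gnoDensity η := by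
    rw [Finset.sum_const, Finset.card_univ, nsmul_eq_mul]
  have h1 : KL L * ∫ η : GnoCoord L, gnoDensity η ≤ 1 := by
    have e : KL L * ∑ _ε : GnoSign L, ∫ η : GnoCoord L, gnoDensity η = 1 := by unfold KL; exact htot
    rw [hsum] at e
    nlinarith [mul_nonneg hKL0.le hρ0]
  -- `∫ρ ≤ 1/K_L ≤ e^{…}`
  have h2 : ∫ η : GnoCoord L, gnoDensity η ≤ (KL L)⁻¹ := by
    rw [← one_div]
    exact (le_div_iff₀' hKL0).2 h1
  calc ∫ η : GnoCoord L, gnoDensity η ≤ (KL L)⁻¹ := h2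
    _ ≤ (Real.exp (-(|Real.log (coneConst ^ 3 / 64)| + 18 * (L : ℝ) ^ 4)))⁻¹ := inv_anti₀ (Real.exp_pos _) hKL
    _ = Real.exp (|Real.log (coneConst ^ 3 / 64)| + 18 * (L : ℝ) ^ 4) := by rw [Real.exp_neg, inv_inv]

end Summit.QuantumFields.YangMills.Theorems.SwapVirialDeficit.SectorLaplace

end
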